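import Literature.RepresentationTheory.Ichino2022.FockKTypeCorrespondence

/-!
# Konno–Konno 2007, §5.2 Lemma 5.3 / Thm 5.4 at the signature `U(2,1) × U(2,0)` (a positive-definite PLANE against
# `U(2,1)`): the explicit polynomial Fock model `ℂ[z_{aj}, w_j]`, its joint harmonics, the highest-weight vectors
# `Δ_{abcd}`, and Ichino's Lemma 7.10 dictionary over it (checked skeleton; sibling file `…JointHarmonicsMixedPlane`
# treats `U(2,1) × U(1,1)`)

Source: T. Konno, K. Konno, *On doubling construction for real unitary dual pairs*, Kyushu J. Math. **61** (2007)
35–82, doi:10.2206/kyushujm.61.35 — bib key `KonnoKonno2007`; held as [corpus: paper:doi-10-2206-kyushujm-61-35]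
(`pNNNN.txt`, journal page = PDF page + 34; prose legible, displayed weight formulae column-scrambled and therefore
READ, not quoted — the extraction caveat K-1 recorded in `…KonnoKonno2007.FockModelUnitaryDualPair` §3).  The
`K × K′`-dictionary is A. Ichino, Adv. Math. **398** (2022) 108188 §7.5 Lemma 7.10 [Ichino2022ThetaReal], whose
printed proof is "Given our choice of the datum `(χ_V, χ_W, ψ)`, the assertion follows from [Konno–Konno 2007]"
(`…Ichino2022.FockKTypeCorrespondence`, [corpus: paper:arxiv-2008.06174 p0020 L9–22]).

## The printed architecture (verbatim where legible)

* §5.1 p. 71 L5–7 (p0037): "*Their intersection `J_{V,W,ξ} := H_V(K_W) ∩ H_W(K_V)` is called the space of joint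
  harmonics. Propositions 4.4(ii) and (iii) for `(V, W±)`, `(V±, W)` in place of `(V, W)` show that `J_{V,W,ξ}`
  consists of `P ∈ P_{V,W,ξ}` killed by*" (5.1) — four families of second-order operators (display legible in
  structure, p0037 L10–48): `Σ_{ℓ ∈ W⁺} ∂²/∂w_{j,ℓ}∂w_{p+k,ℓ}` and `Σ_{ℓ ∈ W⁻} ∂²/∂w_{j,ℓ}∂w_{p+k,ℓ}`
  (`1 ≤ j ≤ p`, `1 ≤ k ≤ q`: one `V⁺`-row and one `V⁻`-row contracted along the `W⁺`-, resp. `W⁻`-columns), and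
  `Σ_{ℓ ∈ V⁺} ∂²/∂w_{ℓ,j}∂w_{ℓ,p′+k}`, `Σ_{ℓ ∈ V⁻} ∂²/∂w_{ℓ,j}∂w_{ℓ,p′+k}` (`1 ≤ j ≤ p′`, `1 ≤ k ≤ q′`);
  Fact 5.1 (2) [How89, §3] (p0037 L54–59): "*`J_{V,W,ξ}` is multiplicity free as a `K_V × K_W`-module, so that it gives
  a bijection `R(K_V, J_{V,W,ξ}) ∋ τ_V ⟷ θ_ξ(τ_V, K_W) ≃ τ_W ∈ R(K_W, J_{V,W,ξ})`*".
* §5.2 p. 72 L5–6 (p0038): "*5.2. Highest weight vectors. The calculation in this subsection is essentially due to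
  Kashiwara–Vergne [KV78].*"; L11–13: "*Let `d_ℓ(w_{j,k}), d⁻_ℓ(w_{j,k}) ∈ ℂ[M_{m,n}(ℂ)]` be the minor determinants*"
  (leading / trailing `ℓ × ℓ` minors); L68–69: "*Next we set, for a decreasing series `a = (a₁, …, a_r)` in `ℤ^r_{>0}`,
  `Δ_a(w_{j,k}) := d_1(w_{j,k})^{a₁−a₂} ⋯ d_{r−1}(w_{j,k})^{a_{r−1}−a_r} d_r(w_{j,k})^{a_r}`*".
* p. 73 L153–158 (p0039): "*Take four decreasing series `a = (a₁, …, a_r)`, `b`, `c`, `d` in `ℤ_{>0}` whose lengths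
  satisfy `r ≤ min(p, p′)`, `s ≤ min(p, q′)`, `t ≤ min(q, p′)`, `u ≤ min(q, q′)`. We set
  `Δ_{abcd}(w_{j,k}) := Δ_a(w_{j,k}) Δ⁻_b(w_{j,p′+k}) Δ_c(w_{p+j,k}) Δ_d(w_{p+j,p′+k})`*" — one factor per block
  `V⁺⊗W⁺`, `V⁺⊗W⁻`, `V⁻⊗W⁺`, `V⁻⊗W⁻` of the variables.
* **Lemma 5.3** p. 74 L17–19, L49–52 (p0040): "*(1) The case `d_ψ i < 0`. (i) `Δ_{abcd}` is a `b̄_V ⊕ b_W`-highest weight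
  vector in `P_{V,W,ξ}` of `t_{V,ℂ}`-weight* [display] *(ii) `Δ_{abcd}` belongs to `J_{V,W,ξ}` if and only if
  `r + s ≤ p`, `t + u ≤ q`, `r + t ≤ p′`, `s + u ≤ q′`. (iii) Any `b̄_V ⊕ b_W`-highest weight vector in the
  `k_{V,ℂ} ⊕ k_{W,ℂ}`-module `J_{V,W,ξ}` is of the form `Δ_{abcd}`.*"; p. 75 L30–31 (p0041): "*Proof. Only (iii) needs an
  explanation. However, this is proved in the same way as in [KV78, Proposition III 6.1]. We omit the details.*"
* **Theorem 5.4** (K-type correspondence) p. 75 L38–39, L67–69, L98–100 (p0041): "*(i) Write the `𝔟_{V,ψ}`-highest weight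
  of a `K_V`-type `τ_V` as* (5.6) *for some `a₁ ≥ ⋯ ≥ a_r, b₁ ≥ ⋯ ≥ b_s, c₁ ≥ ⋯ ≥ c_t, d₁ ≥ ⋯ ≥ d_u ∈ ℤ_{>0}`. Then `τ_V`
  belongs to `R(K_V, J_{V,W,ξ})` if and only if `r + t ≤ p′`, `s + u ≤ q′`. In that case, the `𝔟_{W,ψ}`-highest weight
  of `θ_ξ(τ_V, K_W)` is given by* (5.7). *(ii) Conversely, a `K_W`-type `τ_W` with the `𝔟_{W,ψ}`-highest weight (5.7)
  belongs to `R(K_W, J_{V,W,ξ})` if and only if `r + s ≤ p`, `t + u ≤ q`. In that case, `θ_ξ(τ_W, K_V)` has the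
  `𝔟_{V,ψ}`-highest weight (5.6).*"

## What this file does

The print is typed in the TREE's conventions, not transcribed index-for-index: the tree's junction realises
`𝕎 = V ⊗ W` (Konno–Konno: `P(w) ↦ P(g⁻¹ w g′)`, i.e. `V* ⊗ W`, cf. `RealDualPair.not_fockVacuumCharacter_kk07Reading`),
with the block datum `dualPairι` of `…SegalBargmann.FockDualPairCompact` (same-sign blocks carry the STANDARD
Kronecker representations of `K_V × K_W`, mixed blocks the CONJUGATE ones — `…SchwartzDegreeOneKTypes
.unitaryOpPi_dualPairι_degOne`; polynomial torus weights `+1` per degree on the same-sign blocks, `−1` on the mixed ones —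
`torusChar_dpTorus`), and highest weights for BOTH groups w.r.t. the upper-triangular Borels (killed by the
`e_{01}`-type raising operators; Ichino's dominant parametrisation `a₁ ≥ a₂ ≥ …`).  In these conventions, for
`G_V = U(2,1)` (`V⁺ = ℂ²` rows `a ∈ Fin 2`, `V⁻ = ℂ`) and `W` a positive-definite PLANE (`W⁺ = ℂ²`, columns `j ∈ Fin 2`;
Ichino `(p,q;r,s) = (2,0;2,1)` — the signature of the two-line pair `W = W₁ ⊕ W₂` at the place `ι₁` of the `U(2,1)`
theta bookkeeping of Picard modular surfaces; `…Ichino2022.FockKTypeWorkedPlanes.corresponds_wedge_iff_posPlane` is its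
first consumer), namespace `PosPlane`:

* §A.1–A.2: the model `ℂ[z_{aj}, w_j]` (`z` the `V⁺⊗W⁺` block, `w` the mixed `V⁻⊗W⁺` block), the five torus weights,
  the joint-harmonic operators `Δ_a = Σ_j ∂_{z_{aj}}∂_{w_j}` (the only family of (5.1) that survives `W⁻ = 0`), the
  raising operators `E_V = Σ_j z_{0j}∂_{z_{1j}}` of `𝔲(2)_V` and `E_W = Σ_a z_{a0}∂_{z_{a1}} − w_1∂_{w_0}` of `𝔲(2)_W`
  (conjugate on `w`), and the predicate `IsHWVector` (joint harmonic `K_V × K_W`-highest-weight vector with given weights);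
* §A.3: the vectors `Δ_{abcd}` of this signature, `kkVec α β d = z_{00}^α · (det z)^β · w_1^d` (`a = (α+β ≥ β)` on
  `V⁺⊗W⁺`: leading minors `z_{00}`, `det z`; `c = (d)` on `V⁻⊗W⁺`: the trailing entry `w_1`, highest for the conjugate
  column action; `b`, `d` empty); PROVED: Lemma 5.3 (i)–(ii) for them — `isHWVector_kkVec` (weights `U(W)`: `(α+β, β−d)`,
  `U(2)_V`: `(α+β, β)`, `w`-degree `d`) under (ii)'s only non-vacuous constraint `r + t ≤ p′ = 2`, i.e. `β = 0 ∨ d = 0`,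
  and the witness `not_isHarmonic_detZ_mul_w` that the constraint is sharp;
* §A.4: the `FockHarmonics` dictionary of `…Ichino2022.FockKTypeCorrespondence` over the model (`explicitPosPlane`:
  "`μ ⊠ μ′` occurs in the joint harmonics" := some joint harmonic highest-weight vector has the polynomial weights
  `(μ; μ′)` minus Ichino's printed vacuum shifts), the PROVED half of Lemma 7.10 / Thm 5.4 (ii) (`corresponds_mu_mu'`:
  every printed parameter is realised by a `kkVec`), and the REDUCTION of the full lemma to Lemma 5.3 (iii) at this
  signature (`lemma_7_10_of_classification`: if every joint harmonic highest-weight vector has the WEIGHTS of some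
  admissible `kkVec`, then `Lemma_7_10` holds for the model) — (iii) is the statement a closing seat proves ("in the same
  way as in [KV78, Prop. III 6.1]"; for the line `U(2,1) × U(1)` it is the tree's `…Ichino2022.ExplicitLine.isHWVector_iff`).

Nothing is asserted: every `def` has a body, every theorem is proved; no `def … : Prop` record is introduced.  The
identification of this polynomial model with the `K × K′`-finite vectors of a constructed archimedean Weil datum
(Bargmann transform, `…SegalBargmann.FockExplicitLineJunction` for the line) is NOT made here.

## References

* [KonnoKonno2007] T. Konno, K. Konno, Kyushu J. Math. 61 (2007) 35–82, §5.1 (5.1), Fact 5.1, §5.2 Lemma 5.3, Thm 5.4.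
* [Ichino2022ThetaReal] A. Ichino, Adv. Math. 398 (2022) 108188, §4.1, §7.5 Lemma 7.10.
* [KashiwaraVergne1978] M. Kashiwara, M. Vergne, Invent. Math. 44 (1978) 1–47, Ch. III §5 (5.1), Prop. 6.1.
* [Howe1989Transcending] R. Howe, J. AMS 2 (1989) 535–552, §3 (joint harmonics; cited by KK07 as [How89]).

Provenance: pub-hodgecm2 literature fan-out row B09-1 (typer seat `literature-prover-pub-hodgecm2-t-b09-1`).
-/

namespace Literature.RepresentationTheory.KonnoKonno2007

open MvPolynomial Finsupp
open Literature.RepresentationTheory.Ichino2022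

noncomputable section

/-! ## §0 Two generic tools on polynomial rings -/

section Tools

variable {σ : Type*}

/-- Partial derivatives of polynomials commute. [folklore] -/
private theorem pderiv_pderiv_comm' (i j : σ) (p : MvPolynomial σ ℂ) :
    pderiv i (pderiv j p) = pderiv j (pderiv i p) := by
  classical
  induction p using MvPolynomial.induction_on with
  | C a => simp only [pderiv_C, map_zero]
  | add p q hp hq => simp only [map_add, hp, hq]
  | mul_X p k hp =>
    simp only [pderiv_mul, map_add, hp, pderiv_X]
    by_cases hik : i = k <;> by_cases hjk : j = k <;> simp [hik, hjk, eq_comm]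

/-- A second-order operator `∂_i ∂_j` kills a polynomial in which `j` does not occur. [folklore] -/
private theorem pderiv_pderiv_eq_zero_of_notMem_right (i j : σ) {p : MvPolynomial σ ℂ} (h : j ∉ p.vars) :
    pderiv i (pderiv j p) = 0 := by
  rw [pderiv_eq_zero_of_notMem_vars h, map_zero]

/-- A second-order operator `∂_i ∂_j` kills a polynomial in which `i` does not occur. [folklore] -/
private theorem pderiv_pderiv_eq_zero_of_notMem_left (i j : σ) {p : MvPolynomial σ ℂ} (h : i ∉ p.vars) :
    pderiv i (pderiv j p) = 0 := by
  rw [pderiv_pderiv_comm', pderiv_eq_zero_of_notMem_vars h, map_zero]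

/-- `vars (X i ^ n) ⊆ {i}`. [folklore] -/
private theorem vars_X_pow_subset (i : σ) (n : ℕ) : ((X i : MvPolynomial σ ℂ) ^ n).vars ⊆ {i} := by
  classical
  refine (vars_pow _ _).trans ?_
  rw [vars_X]

end Tools

/-! ## Part A.  `W` a positive-definite plane: the model `ℂ[z_{aj}, w_j]` of `U(2,1) × U(2)` (Ichino `(2,0;2,1)`) -/

namespace PosPlane

/-- Variables of the Fock model of `U(2,1) × U(2,0)`: `inl (a, j)` is `z_{aj}` (`a ∈ Fin 2` a row of `V⁺`,
`j ∈ Fin 2` a column of `W = W⁺`; the same-sign block `V⁺ ⊗ W⁺`), `inr j` is `w_j` (the mixed block `V⁻ ⊗ W⁺`).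
[cite: KonnoKonno2007, §5.2 p. 73] -/
abbrev Var : Type := (Fin 2 × Fin 2) ⊕ Fin 2

/-- The explicit Fock model `ℂ[z_{aj}, w_j]_{a,j ∈ Fin 2}` of `U(2,1) × U(2,0)`. [cite: KonnoKonno2007, Prop 4.4 (i) p. 68] -/
abbrev Model : Type := MvPolynomial Var ℂ

/-! ### A.1 Torus weights (tree convention: `+1` per degree on the same-sign block, `−1` on the mixed block) -/

/-- `U(W)`-torus weight of the `j`-th column circle: `z_{aj} ↦ +1` (column `j`), `w_j ↦ −1`, else `0`.
[cite: KonnoKonno2007, Lemma 5.2 p. 73] -/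
def colW (j : Fin 2) : Var → ℤ
  | Sum.inl aj => if aj.2 = j then 1 else 0
  | Sum.inr j' => if j' = j then -1 else 0

/-- `U(2)_V`-torus (row) weight: `z_{aj} ↦ +1` (row `a`), `w_j ↦ 0`. [cite: KonnoKonno2007, Lemma 5.2 p. 73] -/
def rowW (a : Fin 2) : Var → ℤ
  | Sum.inl aj => if aj.1 = a then 1 else 0
  | Sum.inr _ => 0

/-- the `w`-degree (the `U(1)_V = U(V⁻)`-weight is MINUS it, relative to the vacuum). [cite: KonnoKonno2007, Lemma 5.2 p. 73] -/
def wDeg : Var → ℤ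
  | Sum.inl _ => 0
  | Sum.inr _ => 1

/-! ### A.2 The operators: joint harmonics (5.1), raising operators of `𝔲(2)_V` and `𝔲(2)_W` -/

/-- **`Δ_a = Σ_j ∂_{z_{aj}} ∂_{w_j}`** (`a ∈ Fin 2`): the family of (5.1) contracting a `V⁺`-row with the `V⁻`-row along
the `W⁺`-columns — for `W⁻ = 0` the only non-empty family, so the joint harmonics are `ker Δ₀ ∩ ker Δ₁`.
[cite: KonnoKonno2007, §5.1 (5.1) p. 71] -/
def Delta (a : Fin 2) : Model →ₗ[ℂ] Model :=
  ∑ j : Fin 2, (pderiv (Sum.inl (a, j))).toLinearMap ∘ₗ (pderiv (Sum.inr j)).toLinearMap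

/-- [cite: KonnoKonno2007, §5.1 (5.1) p. 71] -/
theorem Delta_apply (a : Fin 2) (f : Model) :
    Delta a f = ∑ j : Fin 2, pderiv (Sum.inl (a, j)) (pderiv (Sum.inr j) f) := by
  simp [Delta]

/-- Generator images of the raising operator of `𝔲(2)_V`: `z_{1j} ↦ z_{0j}`, all other variables `↦ 0`. [folklore] -/
def evGen : Var → Model
  | Sum.inl aj => if aj.1 = 1 then X (Sum.inl (0, aj.2)) else 0
  | Sum.inr _ => 0

/-- **`E_V = Σ_j z_{0j} ∂_{z_{1j}}`**, the raising operator `e_{01}` of `𝔲(2)_V ⊗ ℂ` (standard representation on the rows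
of the same-sign block; `V⁻` does not see it), as a derivation. [cite: KonnoKonno2007, §5.2 (5.3) p. 72] -/
def EV : Derivation ℂ Model Model := mkDerivation ℂ evGen

/-- unfolding `E_V` on a variable. [cite: KonnoKonno2007, §5.2 (5.3) p. 72] -/
@[simp] theorem EV_X (v : Var) : EV (X v) = evGen v := mkDerivation_X _ _ _

/-- Generator images of the raising operator of `𝔲(2)_W`: `z_{a1} ↦ z_{a0}` (standard on the same-sign block),
`w_0 ↦ −w_1` (CONJUGATE on the mixed block), else `0`. [folklore] -/
def ewGen : Var → Model
  | Sum.inl aj => if aj.2 = 1 then X (Sum.inl (aj.1, 0)) else 0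
  | Sum.inr j => if j = 0 then -X (Sum.inr 1) else 0

/-- **`E_W = Σ_a z_{a0} ∂_{z_{a1}} − w_1 ∂_{w_0}`**, the raising operator `e_{01}` of `𝔲(2)_W ⊗ ℂ` (standard on the columns
of `z`, conjugate on `w`), as a derivation. [cite: KonnoKonno2007, §5.2 (5.3) p. 72] -/
def EW : Derivation ℂ Model Model := mkDerivation ℂ ewGen

/-- unfolding `E_W` on a variable. [cite: KonnoKonno2007, §5.2 (5.3) p. 72] -/
@[simp] theorem EW_X (v : Var) : EW (X v) = ewGen v := mkDerivation_X _ _ _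

/-- **The joint harmonics** `J = ker Δ₀ ∩ ker Δ₁` of the model. [cite: KonnoKonno2007, §5.1 (5.1) p. 71] -/
def IsHarmonic (f : Model) : Prop := ∀ a : Fin 2, Delta a f = 0

/-- **A joint `K_V × K_W`-highest-weight vector in the joint harmonics** with `U(W)`-weight `(k₀, k₁)`, `U(2)_V`-weight
`(n₀, n₁)` and `w`-degree `e`: non-zero, harmonic, a weight vector of the five circles, killed by `E_V` and `E_W`.
[cite: KonnoKonno2007, Lemma 5.3 p. 74] -/
structure IsHWVector (f : Model) (k₀ k₁ n₀ n₁ e : ℤ) : Prop where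
  /-- non-zero -/
  ne : f ≠ 0
  /-- joint harmonic -/
  harm : IsHarmonic f
  /-- `U(W)`-weight, column `0` -/
  col0 : IsWeightedHomogeneous (colW 0) f k₀
  /-- `U(W)`-weight, column `1` -/
  col1 : IsWeightedHomogeneous (colW 1) f k₁
  /-- `U(2)_V`-weight, row `0` -/
  row0 : IsWeightedHomogeneous (rowW 0) f n₀
  /-- `U(2)_V`-weight, row `1` -/
  row1 : IsWeightedHomogeneous (rowW 1) f n₁
  /-- `w`-degree -/
  wdeg : IsWeightedHomogeneous wDeg f e
  /-- killed by the raising operator of `𝔲(2)_V` -/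
  hV : EV f = 0
  /-- killed by the raising operator of `𝔲(2)_W` -/
  hW : EW f = 0

/-! ### A.3 The vectors `Δ_{abcd}` of this signature and Lemma 5.3 (i)–(ii) for them -/

/-- `det z = z_{00} z_{11} − z_{01} z_{10}`, the `2 × 2` leading minor `d₂` of the same-sign block.
[cite: KonnoKonno2007, §5.2 p. 72] -/
def detZ : Model := X (Sum.inl (0, 0)) * X (Sum.inl (1, 1)) - X (Sum.inl (0, 1)) * X (Sum.inl (1, 0))

/-- **`Δ_{abcd}` at `U(2,1) × U(2,0)`**: `kkVec α β d = z_{00}^α · (det z)^β · w_1^d` — the series `a = (α+β, β)` on the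
block `V⁺⊗W⁺` (leading minors `z_{00}`, `det z`) and `c = (d)` on `V⁻⊗W⁺` (the entry `w_1`, highest for the conjugate
column action); `b`, `d` are empty (`W⁻ = 0`). [cite: KonnoKonno2007, §5.2 p. 73] -/
def kkVec (α β d : ℕ) : Model := X (Sum.inl (0, 0)) ^ α * detZ ^ β * X (Sum.inr 1) ^ d

/-- `vars (det z) ⊆` the four `z`-variables. [folklore] -/
private theorem vars_detZ_subset :
    detZ.vars ⊆ {Sum.inl (0, 0), Sum.inl (1, 1), Sum.inl (0, 1), Sum.inl (1, 0)} := by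
  classical
  unfold detZ
  refine Finset.Subset.trans (vars_sub_subset _) (Finset.union_subset ?_ ?_)
  · refine (vars_mul _ _).trans (Finset.union_subset ?_ ?_) <;> rw [vars_X] <;> decide
  · refine (vars_mul _ _).trans (Finset.union_subset ?_ ?_) <;> rw [vars_X] <;> decide

/-- No `w`-variable occurs in `z_{00}^α (det z)^β`. [folklore] -/
private theorem inr_notMem_vars_zPart (α β : ℕ) (j : Fin 2) :
    Sum.inr j ∉ ((X (Sum.inl (0, 0)) : Model) ^ α * detZ ^ β).vars := by
  classical
  intro h
  have h' := vars_mul _ _ h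
  rw [Finset.mem_union] at h'
  rcases h' with h' | h'
  · have := vars_X_pow_subset _ _ h'
    simp at this
  · have := vars_detZ_subset (vars_pow _ _ h')
    simp at this

/-- `z_{a1}` does not occur in `z_{00}^α`. [folklore] -/
private theorem inl_one_notMem_vars_X00_pow (α : ℕ) (a : Fin 2) :
    Sum.inl (a, (1 : Fin 2)) ∉ ((X (Sum.inl (0, 0)) : Model) ^ α).vars := by
  intro h
  have := vars_X_pow_subset _ _ h
  simp at this

/-- The variables of `kkVec α β d` are among the four `z`'s and `w_1` (never `w_0`). [folklore] -/
private theorem vars_kkVec_subset (α β d : ℕ) :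
    (kkVec α β d).vars ⊆ {Sum.inl (0, 0), Sum.inl (1, 1), Sum.inl (0, 1), Sum.inl (1, 0), Sum.inr 1} := by
  classical
  unfold kkVec
  refine (vars_mul _ _).trans (Finset.union_subset ((vars_mul _ _).trans (Finset.union_subset ?_ ?_)) ?_)
  · exact (vars_X_pow_subset _ _).trans (by decide)
  · exact ((vars_pow _ _).trans vars_detZ_subset).trans (by decide)
  · exact (vars_X_pow_subset _ _).trans (by decide)

/-- With `β = 0` the variables of `kkVec α 0 d = z_{00}^α w_1^d` are among `z_{00}`, `w_1`. [folklore] -/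
private theorem vars_kkVec_zero_subset (α d : ℕ) : (kkVec α 0 d).vars ⊆ {Sum.inl (0, 0), Sum.inr 1} := by
  classical
  unfold kkVec
  rw [pow_zero, mul_one]
  refine (vars_mul _ _).trans (Finset.union_subset ?_ ?_)
  · exact (vars_X_pow_subset _ _).trans (by decide)
  · exact (vars_X_pow_subset _ _).trans (by decide)

/-- **Lemma 5.3 (ii), the harmonic half, at `U(2,1) × U(2,0)`**: under `r + t ≤ p′ = 2` (`β = 0 ∨ d = 0`) the vector
`z_{00}^α (det z)^β w_1^d` is a joint harmonic. [cite: KonnoKonno2007, Lemma 5.3 (ii) p. 74] -/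
theorem isHarmonic_kkVec (α β d : ℕ) (h : β = 0 ∨ d = 0) : IsHarmonic (kkVec α β d) := by
  classical
  intro a
  rw [Delta_apply, Fin.sum_univ_two]
  have h0 : pderiv (Sum.inl (a, (0 : Fin 2))) (pderiv (Sum.inr 0) (kkVec α β d)) = 0 :=
    pderiv_pderiv_eq_zero_of_notMem_right _ _ fun hm => by simpa using vars_kkVec_subset α β d hm
  rw [h0, zero_add]
  rcases h with hβ | hd
  · -- `β = 0`: `kkVec = z_{00}^α w_1^d` contains no `z_{a1}`
    subst hβ
    exact pderiv_pderiv_eq_zero_of_notMem_left _ _ fun hm => by simpa using vars_kkVec_zero_subset α d hm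
  · -- `d = 0`: no `w` at all
    subst hd
    refine pderiv_pderiv_eq_zero_of_notMem_right _ _ fun hm => ?_
    unfold kkVec at hm
    rw [pow_zero, mul_one] at hm
    exact inr_notMem_vars_zPart α β 1 hm

/-! #### Weights of `Δ_{abcd}` (Lemma 5.3 (i), the torus part) -/

/-- transport of a weighted-homogeneity statement along an equality of weights. [folklore] -/
private theorem isWeightedHomogeneous_congr {w : Var → ℤ} {f : Model} {m n : ℤ} (h : IsWeightedHomogeneous w f m)
    (e : m = n) : IsWeightedHomogeneous w f n := e ▸ h

/-- `det z` has weight `1` for each column circle of `U(W)`. [cite: KonnoKonno2007, §5.2 (5.2) p. 72] -/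
theorem isWeightedHomogeneous_colW_detZ (j : Fin 2) : IsWeightedHomogeneous (colW j) detZ 1 := by
  refine (weightedHomogeneousSubmodule ℂ (colW j) (1 : ℤ)).sub_mem ?_ ?_
  · refine isWeightedHomogeneous_congr ((isWeightedHomogeneous_X _ _ _).mul (isWeightedHomogeneous_X _ _ _)) ?_
    fin_cases j <;> simp [colW]
  · refine isWeightedHomogeneous_congr ((isWeightedHomogeneous_X _ _ _).mul (isWeightedHomogeneous_X _ _ _)) ?_
    fin_cases j <;> simp [colW]

/-- `det z` has weight `1` for each row circle of `U(2)_V`. [cite: KonnoKonno2007, §5.2 (5.2) p. 72] -/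
theorem isWeightedHomogeneous_rowW_detZ (a : Fin 2) : IsWeightedHomogeneous (rowW a) detZ 1 := by
  refine (weightedHomogeneousSubmodule ℂ (rowW a) (1 : ℤ)).sub_mem ?_ ?_
  · refine isWeightedHomogeneous_congr ((isWeightedHomogeneous_X _ _ _).mul (isWeightedHomogeneous_X _ _ _)) ?_
    fin_cases a <;> simp [rowW]
  · refine isWeightedHomogeneous_congr ((isWeightedHomogeneous_X _ _ _).mul (isWeightedHomogeneous_X _ _ _)) ?_
    fin_cases a <;> simp [rowW]

/-- `det z` has `w`-degree `0` (the `U(V⁻)`-circle does not see the `V⁺⊗W⁺` block). [cite: KonnoKonno2007, §5.2 (5.2) p. 72] -/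
theorem isWeightedHomogeneous_wDeg_detZ : IsWeightedHomogeneous wDeg detZ 0 := by
  refine (weightedHomogeneousSubmodule ℂ wDeg (0 : ℤ)).sub_mem ?_ ?_
  · exact isWeightedHomogeneous_congr ((isWeightedHomogeneous_X _ _ _).mul (isWeightedHomogeneous_X _ _ _))
      (by simp [wDeg])
  · exact isWeightedHomogeneous_congr ((isWeightedHomogeneous_X _ _ _).mul (isWeightedHomogeneous_X _ _ _))
      (by simp [wDeg])

/-- `U(W)`-weight of `kkVec α β d` on column `0`: `α + β`. [cite: KonnoKonno2007, Lemma 5.3 (i) p. 74] -/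
theorem isWeightedHomogeneous_colW_zero_kkVec (α β d : ℕ) :
    IsWeightedHomogeneous (colW 0) (kkVec α β d) ((α : ℤ) + β) := by
  refine isWeightedHomogeneous_congr ((((isWeightedHomogeneous_X _ _ _).pow α).mul
    ((isWeightedHomogeneous_colW_detZ 0).pow β)).mul ((isWeightedHomogeneous_X _ _ _).pow d)) ?_
  simp [colW]

/-- `U(W)`-weight of `kkVec α β d` on column `1`: `β − d` (the entry `w_1` of the conjugate block weighs `−1`).
[cite: KonnoKonno2007, Lemma 5.3 (i) p. 74] -/
theorem isWeightedHomogeneous_colW_one_kkVec (α β d : ℕ) :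
    IsWeightedHomogeneous (colW 1) (kkVec α β d) ((β : ℤ) - d) := by
  refine isWeightedHomogeneous_congr ((((isWeightedHomogeneous_X _ _ _).pow α).mul
    ((isWeightedHomogeneous_colW_detZ 1).pow β)).mul ((isWeightedHomogeneous_X _ _ _).pow d)) ?_
  simp [colW]
  ring

/-- `U(2)_V`-weight of `kkVec α β d` on row `0`: `α + β`. [cite: KonnoKonno2007, Lemma 5.3 (i) p. 74] -/
theorem isWeightedHomogeneous_rowW_zero_kkVec (α β d : ℕ) :
    IsWeightedHomogeneous (rowW 0) (kkVec α β d) ((α : ℤ) + β) := by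
  refine isWeightedHomogeneous_congr ((((isWeightedHomogeneous_X _ _ _).pow α).mul
    ((isWeightedHomogeneous_rowW_detZ 0).pow β)).mul ((isWeightedHomogeneous_X _ _ _).pow d)) ?_
  simp [rowW]

/-- `U(2)_V`-weight of `kkVec α β d` on row `1`: `β`. [cite: KonnoKonno2007, Lemma 5.3 (i) p. 74] -/
theorem isWeightedHomogeneous_rowW_one_kkVec (α β d : ℕ) :
    IsWeightedHomogeneous (rowW 1) (kkVec α β d) (β : ℤ) := by
  refine isWeightedHomogeneous_congr ((((isWeightedHomogeneous_X _ _ _).pow α).mul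
    ((isWeightedHomogeneous_rowW_detZ 1).pow β)).mul ((isWeightedHomogeneous_X _ _ _).pow d)) ?_
  simp [rowW]

/-- `w`-degree of `kkVec α β d`: `d`. [cite: KonnoKonno2007, Lemma 5.3 (i) p. 74] -/
theorem isWeightedHomogeneous_wDeg_kkVec (α β d : ℕ) :
    IsWeightedHomogeneous wDeg (kkVec α β d) (d : ℤ) := by
  refine isWeightedHomogeneous_congr ((((isWeightedHomogeneous_X _ _ _).pow α).mul
    (isWeightedHomogeneous_wDeg_detZ.pow β)).mul ((isWeightedHomogeneous_X _ _ _).pow d)) ?_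
  simp [wDeg]

/-! #### The raising operators kill `Δ_{abcd}` (Lemma 5.3 (i), the nilpotent part) -/

/-- a derivation killing both factors kills the product. [folklore] -/
private theorem derivation_mul_eq_zero {D : Derivation ℂ Model Model} {f g : Model} (hf : D f = 0) (hg : D g = 0) :
    D (f * g) = 0 := by
  rw [D.leibniz, hf, hg, smul_zero, smul_zero, add_zero]

/-- a derivation killing `f` kills its powers. [folklore] -/
private theorem derivation_pow_eq_zero {D : Derivation ℂ Model Model} {f : Model} (hf : D f = 0) (n : ℕ) :
    D (f ^ n) = 0 := by
  rw [D.leibniz_pow, hf, smul_zero, smul_zero]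

/-- `E_V (det z) = 0` (the leading minors are killed by the upper nilpotent of `𝔲(2)_V`).
[cite: KonnoKonno2007, §5.2 (5.3) p. 72] -/
theorem EV_detZ : EV detZ = 0 := by
  simp only [detZ, map_sub, Derivation.leibniz, EV_X, evGen, smul_eq_mul]
  simp
  ring

/-- `E_W (det z) = 0`. [cite: KonnoKonno2007, §5.2 (5.3) p. 72] -/
theorem EW_detZ : EW detZ = 0 := by
  simp only [detZ, map_sub, Derivation.leibniz, EW_X, ewGen, smul_eq_mul]
  simp
  ring

/-- `E_V` kills `kkVec α β d`. [cite: KonnoKonno2007, Lemma 5.3 (i) p. 74] -/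
theorem EV_kkVec (α β d : ℕ) : EV (kkVec α β d) = 0 :=
  derivation_mul_eq_zero (derivation_mul_eq_zero (derivation_pow_eq_zero (by simp [evGen]) α)
    (derivation_pow_eq_zero EV_detZ β)) (derivation_pow_eq_zero (by simp [evGen]) d)

/-- `E_W` kills `kkVec α β d`. [cite: KonnoKonno2007, Lemma 5.3 (i) p. 74] -/
theorem EW_kkVec (α β d : ℕ) : EW (kkVec α β d) = 0 :=
  derivation_mul_eq_zero (derivation_mul_eq_zero (derivation_pow_eq_zero (by simp [ewGen]) α)
    (derivation_pow_eq_zero EW_detZ β)) (derivation_pow_eq_zero (by simp [ewGen]) d)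

/-! #### Non-vanishing and the assembled Lemma 5.3 (i)–(ii) -/

/-- the point `z = 1`, `w = (1,1)` of the variable space (used to see that `det z` and `kkVec` are non-zero). [folklore] -/
def unitPoint : Var → ℂ
  | Sum.inl aj => if aj.1 = aj.2 then 1 else 0
  | Sum.inr _ => 1

/-- `det z ≠ 0` (its value at the identity matrix is `1`). [folklore] -/
private theorem eval_unitPoint_detZ : eval unitPoint detZ = 1 := by
  simp [detZ, unitPoint]

/-- `kkVec α β d` takes the value `1` at `unitPoint`; in particular it is non-zero. [folklore] -/
private theorem eval_unitPoint_kkVec (α β d : ℕ) : eval unitPoint (kkVec α β d) = 1 := by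
  simp [kkVec, eval_unitPoint_detZ, unitPoint]

/-- `kkVec α β d ≠ 0` (a highest weight VECTOR). [cite: KonnoKonno2007, Lemma 5.3 (i) p. 74] -/
theorem kkVec_ne_zero (α β d : ℕ) : kkVec α β d ≠ 0 := fun h => by
  have := eval_unitPoint_kkVec α β d
  rw [h, map_zero] at this
  exact zero_ne_one this

/-- **Lemma 5.3 (i)–(ii) at `U(2,1) × U(2,0)` (tree conventions).**  For `β = 0 ∨ d = 0` — the printed constraint
`r + t ≤ p′` of (ii), here `r ∈ {0,1,2}` the length of `a = (α+β, β)` and `t ∈ {0,1}` that of `c = (d)` — the vector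
`z_{00}^α (det z)^β w_1^d` is a joint harmonic `K_V × K_W`-highest-weight vector with `U(W)`-weight `(α+β, β−d)`,
`U(2)_V`-weight `(α+β, β)` and `w`-degree `d` (`U(V⁻)`-weight `−d` relative to the vacuum).
[cite: KonnoKonno2007, Lemma 5.3 (i)(ii) p. 74] -/
theorem isHWVector_kkVec (α β d : ℕ) (h : β = 0 ∨ d = 0) :
    IsHWVector (kkVec α β d) ((α : ℤ) + β) ((β : ℤ) - d) ((α : ℤ) + β) β d where
  ne := kkVec_ne_zero α β d
  harm := isHarmonic_kkVec α β d h
  col0 := isWeightedHomogeneous_colW_zero_kkVec α β d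
  col1 := isWeightedHomogeneous_colW_one_kkVec α β d
  row0 := isWeightedHomogeneous_rowW_zero_kkVec α β d
  row1 := isWeightedHomogeneous_rowW_one_kkVec α β d
  wdeg := isWeightedHomogeneous_wDeg_kkVec α β d
  hV := EV_kkVec α β d
  hW := EW_kkVec α β d

/-- **The constraint `r + t ≤ p′` of Lemma 5.3 (ii) is sharp here**: `det z · w_1` (`r = 2`, `t = 1`) is NOT a joint
harmonic — `Δ₁ (det z · w_1) = ∂_{z_{11}} det z = z_{00} ≠ 0`. [cite: KonnoKonno2007, Lemma 5.3 (ii) p. 74] -/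
theorem not_isHarmonic_detZ_mul_w : ¬ IsHarmonic (detZ * X (Sum.inr 1)) := by
  classical
  intro H
  have h := congrArg (eval unitPoint) (H 1)
  rw [Delta_apply, Fin.sum_univ_two] at h
  simp [detZ, Derivation.leibniz, pderiv_X, unitPoint] at h

/-! ### A.4 Ichino's Lemma 7.10 over the model: the dictionary, the PROVED half, and the reduction to Lemma 5.3 (iii) -/

section Dictionary

open FockHarmonics HarmonicParam

/-- `Fin n` for `n = 2` has the two elements `0`, `1`. [folklore] -/
private theorem fin_eq_zero_or_one_of_eq_two {n : ℕ} (hn : n = 2) (i : Fin n) :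
    i = ⟨0, by omega⟩ ∨ i = ⟨1, by omega⟩ := by
  have hi : i.val = 0 ∨ i.val = 1 := by have := i.isLt; omega
  rcases hi with hi | hi
  · exact Or.inl (Fin.ext hi)
  · exact Or.inr (Fin.ext hi)

/-- `Fin n` for `n = 1` has the one element `0`. [folklore] -/
private theorem fin_eq_zero_of_eq_one {n : ℕ} (hn : n = 1) (i : Fin n) : i = ⟨0, by omega⟩ :=
  Fin.ext (by have := i.isLt; omega)

/-- **The joint-harmonics correspondence of the explicit model `ℂ[z_{aj}, w_j]`**, as an instance of Ichino's dictionary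
for a datum `S` of signature `(p,q;r,s) = (2,0;2,1)` (`U(W) = U(2,0)`, `U(V) = U(2,1)`): `μ ⊠ μ′` occurs in the joint
harmonics iff some joint harmonic `K_V × K_W`-highest-weight vector has polynomial weights which, SHIFTED by the
printed vacuum weights `(r−s)/2 + m₀/2` (on `U(W)`) and `((p−q)/2; (q−p)/2) + n₀/2` (on `K′ = U(2)_V × U(1)_V`, the
`U(1)_V` acting by MINUS the `w`-degree), are `(μ; μ′)`.
[cite: Ichino2022ThetaReal, §7.5 Lemma 7.10; KonnoKonno2007, Thm 5.4 p. 75] -/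
def explicitPosPlane (S : SplittingDatum) (hp : S.p = 2) (hr : S.r = 2) (hs : S.s = 1) : FockHarmonics S where
  corresponds μ μ' := ∃ (f : Model) (k₀ k₁ n₀ n₁ e : ℤ), IsHWVector f k₀ k₁ n₀ n₁ e ∧
    μ.1 ⟨0, by omega⟩ = (k₀ : ℚ) + ((S.r : ℚ) - S.s) / 2 + (S.m₀ : ℚ) / 2 ∧
    μ.1 ⟨1, by omega⟩ = (k₁ : ℚ) + ((S.r : ℚ) - S.s) / 2 + (S.m₀ : ℚ) / 2 ∧
    μ'.1 ⟨0, by omega⟩ = (n₀ : ℚ) + ((S.p : ℚ) - S.q) / 2 + (S.n₀ : ℚ) / 2 ∧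
    μ'.1 ⟨1, by omega⟩ = (n₁ : ℚ) + ((S.p : ℚ) - S.q) / 2 + (S.n₀ : ℚ) / 2 ∧
    μ'.2 ⟨0, by omega⟩ = -(e : ℚ) + ((S.q : ℚ) - S.p) / 2 + (S.n₀ : ℚ) / 2

variable (S : SplittingDatum) (hp : S.p = 2) (hq : S.q = 0) (hr : S.r = 2) (hs : S.s = 1)
include hq

/-- **The PROVED half of Lemma 7.10 / Thm 5.4 (ii) at `(2,0;2,1)`**: every printed parameter `P` (here: `q⁺ = q⁻ = 0`,
`p⁻ ≤ 1`, `p⁺ + p⁻ ≤ 2`) is realised — `P.mu ⊠ P.mu′` occurs in the joint harmonics of the model, through the vector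
`Δ_{abcd} = kkVec` with `a = (a₁, a₂)`, `c = (−b₁)`. [cite: Ichino2022ThetaReal, §7.5 Lemma 7.10; KonnoKonno2007, Lemma 5.3 (i)(ii) p. 74] -/
theorem corresponds_mu_mu' (P : HarmonicParam S) : (explicitPosPlane S hp hr hs).corresponds P.mu P.mu' := by
  obtain ⟨pp, pm, qp, qm, a, b, c, d, a_anti, b_anti, c_anti, d_anti, a_pos, b_neg, c_pos, d_neg, hPp, hPq, hPr, hPs⟩ :=
    P
  obtain rfl : qp = 0 := by omega
  obtain rfl : qm = 0 := by omega
  have hpm : pm ≤ 1 := by omega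
  rcases Nat.lt_or_ge 1 pp with h2 | h2
  · -- `p⁺ = 2`, `p⁻ = 0`: `a = (a₁ ≥ a₂ > 0)`, the vector `z_{00}^{a₁−a₂} (det z)^{a₂}`
    obtain rfl : pp = 2 := by omega
    obtain rfl : pm = 0 := by omega
    have ha1 : 0 < a 1 := a_pos 1
    have ha01 : a 1 ≤ a 0 := a_anti (show (0 : Fin 2) ≤ 1 by decide)
    obtain ⟨α, hα⟩ : ∃ α : ℕ, (α : ℚ) = (a 0 : ℚ) - (a 1 : ℚ) :=
      ⟨(a 0 - a 1).toNat, by exact_mod_cast Int.toNat_of_nonneg (by omega : (0 : ℤ) ≤ a 0 - a 1)⟩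
    obtain ⟨β, hβ⟩ : ∃ β : ℕ, (β : ℚ) = (a 1 : ℚ) :=
      ⟨(a 1).toNat, by exact_mod_cast Int.toNat_of_nonneg (by omega : (0 : ℤ) ≤ a 1)⟩
    refine ⟨_, _, _, _, _, _, isHWVector_kkVec α β 0 (Or.inr rfl), ?_, ?_, ?_, ?_, ?_⟩
    · rw [mu_fst_apply, pad_head _ _ _ _ (by simp)]; push_cast; linarith
    · rw [mu_fst_apply, pad_head _ _ _ _ (by simp)]; push_cast; linarith
    · rw [mu'_fst_apply, pad_head _ _ _ _ (by simp)]; push_cast; linarith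
    · rw [mu'_fst_apply, pad_head _ _ _ _ (by simp)]; push_cast; linarith
    · rw [mu'_snd_apply, pad_mid _ _ _ _ (by simp) (by simp; omega)]; push_cast; ring
  · rcases Nat.lt_or_ge 0 pp with h1 | h1
    · -- `p⁺ = 1`
      obtain rfl : pp = 1 := by omega
      have ha0 : 0 < a 0 := a_pos 0
      obtain ⟨α, hα⟩ : ∃ α : ℕ, (α : ℚ) = (a 0 : ℚ) :=
        ⟨(a 0).toNat, by exact_mod_cast Int.toNat_of_nonneg (by omega : (0 : ℤ) ≤ a 0)⟩
      rcases Nat.lt_or_ge 0 pm with hm | hm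
      · -- `p⁻ = 1`: the vector `z_{00}^{a₁} w_1^{−b₁}`
        obtain rfl : pm = 1 := by omega
        have hb0 : b 0 < 0 := b_neg 0
        obtain ⟨δ, hδ⟩ : ∃ δ : ℕ, (δ : ℚ) = -(b 0 : ℚ) :=
          ⟨(-(b 0)).toNat, by exact_mod_cast Int.toNat_of_nonneg (by omega : (0 : ℤ) ≤ -(b 0))⟩
        have hb1 : b ⟨1 - (S.p - 1), by omega⟩ = b 0 := by congr 1; exact Fin.ext (by simp; omega)
        have hb2 : b ⟨0 - (S.s - 1), by omega⟩ = b 0 := by congr 1; exact Subsingleton.elim _ _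
        refine ⟨_, _, _, _, _, _, isHWVector_kkVec α 0 δ (Or.inl rfl), ?_, ?_, ?_, ?_, ?_⟩
        · rw [mu_fst_apply, pad_head _ _ _ _ (by simp)]; push_cast; linarith
        · rw [mu_fst_apply, pad_tail _ _ _ _ (by simp) (by simp; omega)]; dsimp only; rw [hb1]; push_cast; linarith
        · rw [mu'_fst_apply, pad_head _ _ _ _ (by simp)]; push_cast; linarith
        · rw [mu'_fst_apply, pad_mid _ _ _ _ (by simp) (by simp; omega)]; push_cast; ring
        · rw [mu'_snd_apply, pad_tail _ _ _ _ (by simp) (by simp; omega)]; dsimp only; rw [hb2]; push_cast; linarith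
      · -- `p⁻ = 0`: the vector `z_{00}^{a₁}`
        obtain rfl : pm = 0 := by omega
        refine ⟨_, _, _, _, _, _, isHWVector_kkVec α 0 0 (Or.inl rfl), ?_, ?_, ?_, ?_, ?_⟩
        · rw [mu_fst_apply, pad_head _ _ _ _ (by simp)]; push_cast; linarith
        · rw [mu_fst_apply, pad_mid _ _ _ _ (by simp) (by simp; omega)]; push_cast; ring
        · rw [mu'_fst_apply, pad_head _ _ _ _ (by simp)]; push_cast; linarith
        · rw [mu'_fst_apply, pad_mid _ _ _ _ (by simp) (by simp; omega)]; push_cast; ring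
        · rw [mu'_snd_apply, pad_mid _ _ _ _ (by simp) (by simp; omega)]; push_cast; ring
    · -- `p⁺ = 0`
      obtain rfl : pp = 0 := by omega
      rcases Nat.lt_or_ge 0 pm with hm | hm
      · -- `p⁻ = 1`: the vector `w_1^{−b₁}`
        obtain rfl : pm = 1 := by omega
        have hb0 : b 0 < 0 := b_neg 0
        obtain ⟨δ, hδ⟩ : ∃ δ : ℕ, (δ : ℚ) = -(b 0 : ℚ) :=
          ⟨(-(b 0)).toNat, by exact_mod_cast Int.toNat_of_nonneg (by omega : (0 : ℤ) ≤ -(b 0))⟩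
        have hb1 : b ⟨1 - (S.p - 1), by omega⟩ = b 0 := by congr 1; exact Fin.ext (by simp; omega)
        have hb2 : b ⟨0 - (S.s - 1), by omega⟩ = b 0 := by congr 1; exact Subsingleton.elim _ _
        refine ⟨_, _, _, _, _, _, isHWVector_kkVec 0 0 δ (Or.inl rfl), ?_, ?_, ?_, ?_, ?_⟩
        · rw [mu_fst_apply, pad_mid _ _ _ _ (by simp) (by simp; omega)]; push_cast; ring
        · rw [mu_fst_apply, pad_tail _ _ _ _ (by simp) (by simp; omega)]; dsimp only; rw [hb1]; push_cast; linarith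
        · rw [mu'_fst_apply, pad_mid _ _ _ _ (by simp) (by simp; omega)]; push_cast; ring
        · rw [mu'_fst_apply, pad_mid _ _ _ _ (by simp) (by simp; omega)]; push_cast; ring
        · rw [mu'_snd_apply, pad_tail _ _ _ _ (by simp) (by simp; omega)]; dsimp only; rw [hb2]; push_cast; linarith
      · -- the vacuum
        obtain rfl : pm = 0 := by omega
        refine ⟨_, _, _, _, _, _, isHWVector_kkVec 0 0 0 (Or.inl rfl), ?_, ?_, ?_, ?_, ?_⟩
        · rw [mu_fst_apply, pad_mid _ _ _ _ (by simp) (by simp; omega)]; push_cast; ring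
        · rw [mu_fst_apply, pad_mid _ _ _ _ (by simp) (by simp; omega)]; push_cast; ring
        · rw [mu'_fst_apply, pad_mid _ _ _ _ (by simp) (by simp; omega)]; push_cast; ring
        · rw [mu'_fst_apply, pad_mid _ _ _ _ (by simp) (by simp; omega)]; push_cast; ring
        · rw [mu'_snd_apply, pad_mid _ _ _ _ (by simp) (by simp; omega)]; push_cast; ring

/-- **Reduction of Lemma 7.10 / Thm 5.4 at `(2,0;2,1)` to Lemma 5.3 (iii).**  If every joint harmonic
`K_V × K_W`-highest-weight vector of the model has the WEIGHTS of some `Δ_{abcd}` — `U(W)`: `(α+β, β−d)`, `U(2)_V`: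
`(α+β, β)`, `w`-degree `d`, with `β = 0 ∨ d = 0` — (Konno–Konno: "*Any `b̄_V ⊕ b_W`-highest weight vector in … `J_{V,W,ξ}`
is of the form `Δ_{abcd}`*", "*proved in the same way as in [KV78, Proposition III 6.1]*"; to be supplied by the closing
seat, cf. `…Ichino2022.ExplicitLine.isHWVector_iff` for the line) then Ichino's Lemma 7.10 HOLDS for the model, for
every choice of the splitting exponents `(m₀, n₀)`.
[cite: KonnoKonno2007, Lemma 5.3 (iii) p. 74, Thm 5.4 p. 75; Ichino2022ThetaReal, §7.5 Lemma 7.10] -/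
theorem lemma_7_10_of_classification
    (H : ∀ (f : Model) (k₀ k₁ n₀ n₁ e : ℤ), IsHWVector f k₀ k₁ n₀ n₁ e →
      ∃ α β d : ℕ, (β = 0 ∨ d = 0) ∧ k₀ = (α : ℤ) + β ∧ k₁ = (β : ℤ) - d ∧ n₀ = (α : ℤ) + β ∧
        n₁ = (β : ℤ) ∧ e = (d : ℤ)) :
    (explicitPosPlane S hp hr hs).Lemma_7_10 := by
  intro μ μ'
  constructor
  · rintro ⟨f, k₀, k₁, n₀, n₁, e, hf, e0, e1, e2, e3, e4⟩
    obtain ⟨α, β, d, hβd, rfl, rfl, rfl, rfl, rfl⟩ := H f k₀ k₁ n₀ n₁ e hf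
    -- shorthand for the coordinate bookkeeping
    have hμ2 : ∀ i : Fin S.q, False := fun i => (Fin.cast hq i).elim0
    rcases Nat.lt_or_ge 0 β with hβ | hβ
    · -- `β > 0`, hence `d = 0`: `p⁺ = 2`, `a = (α+β, β)`
      have hd : d = 0 := by rcases hβd with h | h <;> omega
      subst hd
      let P : HarmonicParam S :=
        { pp := 2, pm := 0, qp := 0, qm := 0, a := ![(α : ℤ) + β, β], b := Fin.elim0, c := Fin.elim0, d := Fin.elim0
          a_anti := by
            intro i j hij
            fin_cases i <;> fin_cases j <;> simp at hij ⊢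
          b_anti := fun i => i.elim0, c_anti := fun i => i.elim0, d_anti := fun i => i.elim0
          a_pos := by intro i; fin_cases i <;> simp <;> omega
          b_neg := fun i => i.elim0, c_pos := fun i => i.elim0, d_neg := fun i => i.elim0
          hp := by omega, hq := by omega, hr := by omega, hs := by omega }
      refine ⟨P, ?_, ?_⟩
      · ext i
        · rcases fin_eq_zero_or_one_of_eq_two hp i with rfl | rfl
          · rw [e0, mu_fst_apply, pad_head _ _ _ _ (by simp [P])]; simp [P]
          · rw [e1, mu_fst_apply, pad_head _ _ _ _ (by simp [P])]; simp [P]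
        · exact (hμ2 i).elim
      · ext i
        · rcases fin_eq_zero_or_one_of_eq_two hr i with rfl | rfl
          · rw [e2, mu'_fst_apply, pad_head _ _ _ _ (by simp [P])]; simp [P]
          · rw [e3, mu'_fst_apply, pad_head _ _ _ _ (by simp [P])]; simp [P]
        · obtain rfl := fin_eq_zero_of_eq_one hs i
          rw [e4, mu'_snd_apply, pad_mid _ _ _ _ (by simp [P]) (by simp [P]; omega)]; push_cast; ring
    · obtain rfl : β = 0 := by omega
      rcases Nat.lt_or_ge 0 α with hα | hα
      · rcases Nat.lt_or_ge 0 d with hd | hd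
        · -- `p⁺ = 1`, `p⁻ = 1`: `a = (α)`, `b = (−d)`
          let P : HarmonicParam S :=
            { pp := 1, pm := 1, qp := 0, qm := 0, a := fun _ => α, b := fun _ => -(d : ℤ), c := Fin.elim0
              d := Fin.elim0
              a_anti := fun _ _ _ => le_rfl, b_anti := fun _ _ _ => le_rfl, c_anti := fun i => i.elim0
              d_anti := fun i => i.elim0
              a_pos := fun _ => by simp; omega, b_neg := fun _ => by simp; omega
              c_pos := fun i => i.elim0, d_neg := fun i => i.elim0
              hp := by omega, hq := by omega, hr := by omega, hs := by omega }
          refine ⟨P, ?_, ?_⟩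
          · ext i
            · rcases fin_eq_zero_or_one_of_eq_two hp i with rfl | rfl
              · rw [e0, mu_fst_apply, pad_head _ _ _ _ (by simp [P])]; simp [P]
              · rw [e1, mu_fst_apply, pad_tail _ _ _ _ (by simp [P]) (by simp [P]; omega)]; simp [P]
            · exact (hμ2 i).elim
          · ext i
            · rcases fin_eq_zero_or_one_of_eq_two hr i with rfl | rfl
              · rw [e2, mu'_fst_apply, pad_head _ _ _ _ (by simp [P])]; simp [P]
              · rw [e3, mu'_fst_apply, pad_mid _ _ _ _ (by simp [P]) (by simp [P]; omega)]; push_cast; ring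
            · obtain rfl := fin_eq_zero_of_eq_one hs i
              rw [e4, mu'_snd_apply, pad_tail _ _ _ _ (by simp [P]) (by simp [P]; omega)]; simp [P]
        · -- `p⁺ = 1`, `p⁻ = 0`: `a = (α)`
          obtain rfl : d = 0 := by omega
          let P : HarmonicParam S :=
            { pp := 1, pm := 0, qp := 0, qm := 0, a := fun _ => α, b := Fin.elim0, c := Fin.elim0, d := Fin.elim0
              a_anti := fun _ _ _ => le_rfl, b_anti := fun i => i.elim0, c_anti := fun i => i.elim0
              d_anti := fun i => i.elim0
              a_pos := fun _ => by simp; omega, b_neg := fun i => i.elim0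
              c_pos := fun i => i.elim0, d_neg := fun i => i.elim0
              hp := by omega, hq := by omega, hr := by omega, hs := by omega }
          refine ⟨P, ?_, ?_⟩
          · ext i
            · rcases fin_eq_zero_or_one_of_eq_two hp i with rfl | rfl
              · rw [e0, mu_fst_apply, pad_head _ _ _ _ (by simp [P])]; simp [P]
              · rw [e1, mu_fst_apply, pad_mid _ _ _ _ (by simp [P]) (by simp [P]; omega)]; push_cast; ring
            · exact (hμ2 i).elim
          · ext i
            · rcases fin_eq_zero_or_one_of_eq_two hr i with rfl | rfl
              · rw [e2, mu'_fst_apply, pad_head _ _ _ _ (by simp [P])]; simp [P]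
              · rw [e3, mu'_fst_apply, pad_mid _ _ _ _ (by simp [P]) (by simp [P]; omega)]; push_cast; ring
            · obtain rfl := fin_eq_zero_of_eq_one hs i
              rw [e4, mu'_snd_apply, pad_mid _ _ _ _ (by simp [P]) (by simp [P]; omega)]; push_cast; ring
      · obtain rfl : α = 0 := by omega
        rcases Nat.lt_or_ge 0 d with hd | hd
        · -- `p⁺ = 0`, `p⁻ = 1`: `b = (−d)`
          let P : HarmonicParam S :=
            { pp := 0, pm := 1, qp := 0, qm := 0, a := Fin.elim0, b := fun _ => -(d : ℤ), c := Fin.elim0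
              d := Fin.elim0
              a_anti := fun i => i.elim0, b_anti := fun _ _ _ => le_rfl, c_anti := fun i => i.elim0
              d_anti := fun i => i.elim0
              a_pos := fun i => i.elim0, b_neg := fun _ => by simp; omega
              c_pos := fun i => i.elim0, d_neg := fun i => i.elim0
              hp := by omega, hq := by omega, hr := by omega, hs := by omega }
          refine ⟨P, ?_, ?_⟩
          · ext i
            · rcases fin_eq_zero_or_one_of_eq_two hp i with rfl | rfl
              · rw [e0, mu_fst_apply, pad_mid _ _ _ _ (by simp [P]) (by simp [P]; omega)]; push_cast; ring
              · rw [e1, mu_fst_apply, pad_tail _ _ _ _ (by simp [P]) (by simp [P]; omega)]; simp [P]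
            · exact (hμ2 i).elim
          · ext i
            · rcases fin_eq_zero_or_one_of_eq_two hr i with rfl | rfl
              · rw [e2, mu'_fst_apply, pad_mid _ _ _ _ (by simp [P]) (by simp [P]; omega)]; push_cast; ring
              · rw [e3, mu'_fst_apply, pad_mid _ _ _ _ (by simp [P]) (by simp [P]; omega)]; push_cast; ring
            · obtain rfl := fin_eq_zero_of_eq_one hs i
              rw [e4, mu'_snd_apply, pad_tail _ _ _ _ (by simp [P]) (by simp [P]; omega)]; simp [P]
        · -- the vacuum
          obtain rfl : d = 0 := by omega
          refine ⟨HarmonicParam.vacuum S, ?_, ?_⟩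
          · rw [HarmonicParam.vacuum_mu]
            ext i
            · rcases fin_eq_zero_or_one_of_eq_two hp i with rfl | rfl
              · rw [e0]; push_cast; ring
              · rw [e1]; push_cast; ring
            · exact (hμ2 i).elim
          · rw [HarmonicParam.vacuum_mu']
            ext i
            · rcases fin_eq_zero_or_one_of_eq_two hr i with rfl | rfl
              · rw [e2]; push_cast; ring
              · rw [e3]; push_cast; ring
            · obtain rfl := fin_eq_zero_of_eq_one hs i
              rw [e4]; push_cast; ring
  · rintro ⟨P, rfl, rfl⟩
    exact corresponds_mu_mu' S hp hq hr hs P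

end Dictionary

end PosPlane

end

end Literature.RepresentationTheory.KonnoKonno2007
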